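import Summits.QuantumFields.YangMills.Theorems.AllWindowsColdBoxBoxHighLineSmallFieldInsideFPSharpCore

/-!
# U5-L5 (iii) = T-S5.6′ `SmallFieldInsideFPSharp` (def-free form): exponent `C·r·H⁴·(1+log H) − c·β·s²` instead of T-S5.6's `C·r·H⁵ − c·β·s²`
# (planner ym-idea-2 g18, `Cruxes/BoxWindowHighSU2213/TaskU5L5.lean`; LINE-20 U5 ⟨stmt-QuantumFields-24336⟩; U5 prep, helper-grade; U5 OPEN)

Width seat `ym-line-sfw-p2-w4` (prover-ym-line-sfw-p2-w4-g29-0), T-S5.6 lineage.  Assembly of the T-S5.6 re-run over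
✓6a′ `abs_action_sub_boxQuadForm_le_sharp` (w2 g32; `δ = C₆·π·r`, NO Poincaré `H`), ✓h6b′ `ghostDetRatio_sq_le` (w3 g40; `K = e^{K₇H⁴(1+log H)⁴(πr)²}`),
✓S3a `landauVarianceBounded`, and w4 g29's ✓`TwoFormGauss.*` (mass ratio `e^{(9+15C₃)/2·δ·n}`, tails, box masses) / ✓`SmallFieldFPSharp.*` cores:

* `six_card_exp_le_half`, `sharp_ratio_assembly`, `bracket_le_sharp` — arithmetic on OPAQUE reals (`n = |LandauFree H|` never meets a tactic);
* ★★ **`smallFieldInsideFP_sharp`** — `∃ C c c₀, 0 < c ∧ 0 < c₀ ∧ ∀ H ≥ 1, ∀ β r s, 1 ≤ β → 0 < s → 4s ≤ r → r·H² ≤ c₀ → C(1+log H) ≤ βs² →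
  ∫_{chartDomain ∖ smallField s} w_J ≤ C·H⁴·exp(C·r·H⁴·(1+log H) − c·β·s²)·∫_{smallField (s/2)} w_J` — the body of the typed Prop `SmallFieldInsideFPSharp`
  token for token (the by-name one-liner with the `def` is the companion file `…SmallFieldInsideFPSharpByName`).
Exponent pieces (all `≤ const·r·H⁴`): determinant `2K₇⁺H⁴(1+log H)⁴π²r² ≤ 8π²K₇⁺·rH⁴` (`(1+log H)⁴ ≤ 16H²`, `rH² ≤ ¼`), Haar `n·s² ≤ 54·rH⁴`,
mass ratio `(9+15C₃)/2·C₆πr·n ≤ 108π(9+15C₃)C₆·rH⁴`; prefactor `12n ≤ 2592H⁴`; `c = (6C₃)⁻¹`.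

Everything proved; no definitions; standard axioms.  HONEST LABEL: U5 prep, helper-grade (lift L5 of the NEXT rung U5 of a critic-PASSed DRAFT line); U5 ⟨24336⟩,
⟨24004⟩ and the seat's own crux ⟨22884⟩ remain OPEN; no stub is closed by name, no crux, rung or summit is proved; **the Yang–Mills mass gap is NOT proved by
this file; no summit is proved by a line.**
-/

set_option autoImplicit false

open MeasureTheory Real Finset

namespace Summit.QuantumFields.YangMills.Theorems.AllWindowsColdBoxBoxHighLine

namespace SmallFieldFPSharp

open SmallFieldFP TwoFormGauss

variable {H : ℕ}

/-! ## Arithmetic on opaque reals -/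

/-- The half box keeps half the PLUS mass: `6n·e^{−β(s/2)²/(3C₃)} ≤ ½` when `C(1+log H) ≤ βs²`, `144C₃ ≤ C`, `n ≤ 216H⁴`. -/
theorem six_card_exp_le_half (hH : 1 ≤ H) {n β s C C₃ : ℝ} (hn : n ≤ 216 * (H : ℝ) ^ 4) (hC₃ : 0 < C₃) (hC : 144 * C₃ ≤ C)
    (hCβ : C * (1 + Real.log H) ≤ β * s ^ 2) :
    6 * n * Real.exp (-(β * (s / 2) ^ 2 / (3 * C₃))) ≤ 1 / 2 := by
  have hH' : (1 : ℝ) ≤ H := by exact_mod_cast hH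
  have hlog : 0 ≤ Real.log H := Real.log_nonneg hH'
  have hE : Real.exp (-(β * (s / 2) ^ 2 / (3 * C₃))) ≤ Real.exp (-(12 * (1 + Real.log H))) := by
    refine Real.exp_le_exp.2 (neg_le_neg ?_)
    rw [le_div_iff₀ (by positivity)]
    have h1 : 144 * C₃ * (1 + Real.log H) ≤ C * (1 + Real.log H) := mul_le_mul_of_nonneg_right hC (by linarith)
    nlinarith
  have h2 := card_mul_exp_neg_le_one hH (le_refl (12 : ℝ))
  calc 6 * n * Real.exp (-(β * (s / 2) ^ 2 / (3 * C₃))) ≤ 6 * (216 * (H : ℝ) ^ 4) * Real.exp (-(12 * (1 + Real.log H))) :=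
        mul_le_mul (by nlinarith) hE (Real.exp_pos _).le (by positivity)
    _ = 2592 * (H : ℝ) ^ 4 * Real.exp (-(12 * (1 + Real.log H))) / 2 := by ring
    _ ≤ 1 / 2 := by linarith

/-- **Ratio assembly** (opaque reals): numerator `≤ K·D₀·P·Icomp`, `Icomp ≤ T₁·Zm`, `Zm ≤ e^E·Zp`; denominator `≥ K⁻¹·D₀·P·e^{−g}·Ibox`, `Ibox ≥ (1−q)·Zp`,
`q ≤ ½` ⇒ `Inum ≤ (2·K²·e^g·e^E·T₁)·Iden`. -/
theorem sharp_ratio_assembly {Inum Iden K D₀ P g Zp Zm Icomp Ibox T₁ E q : ℝ}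
    (hK : 0 < K) (hD₀ : 0 ≤ D₀) (hP : 0 < P) (hZp : 0 < Zp) (hT₁ : 0 ≤ T₁)
    (hU : Inum ≤ K * D₀ * P * Icomp) (htail : Icomp ≤ T₁ * Zm) (hratio : Zm ≤ Real.exp E * Zp)
    (hL : K⁻¹ * D₀ * (P * Real.exp (-g)) * Ibox ≤ Iden) (hbox : (1 - q) * Zp ≤ Ibox) (hq : q ≤ 1 / 2) :
    Inum ≤ (2 * K ^ 2 * Real.exp g * Real.exp E * T₁) * Iden := by
  set G : ℝ := Real.exp g with hGdef
  have hG : 0 < G := Real.exp_pos _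
  have hGinv : Real.exp (-g) = G⁻¹ := by rw [Real.exp_neg]
  rw [hGinv] at hL
  have hE : 0 < Real.exp E := Real.exp_pos _
  -- numerator
  have hnum : Inum ≤ K * D₀ * P * (T₁ * (Real.exp E * Zp)) := by
    refine hU.trans (mul_le_mul_of_nonneg_left ?_ (mul_nonneg (mul_nonneg hK.le hD₀) hP.le))
    exact htail.trans (mul_le_mul_of_nonneg_left hratio hT₁)
  -- denominator
  have hc : 0 ≤ K⁻¹ * D₀ * (P * G⁻¹) := mul_nonneg (mul_nonneg (inv_nonneg.mpr hK.le) hD₀) (mul_nonneg hP.le (inv_nonneg.mpr hG.le))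
  have hden : K⁻¹ * D₀ * (P * G⁻¹) * (1 / 2 * Zp) ≤ Iden := by
    refine le_trans (mul_le_mul_of_nonneg_left ?_ hc) hL
    have h2 : 0 ≤ (1 / 2 - q) * Zp := mul_nonneg (by linarith) hZp.le
    nlinarith
  -- algebra: `K D₀ P T₁ e^E Zp = (2K²G e^E T₁)·(K⁻¹ D₀ P G⁻¹ Zp/2)`
  have hid : K * D₀ * P * (T₁ * (Real.exp E * Zp)) = (2 * K ^ 2 * G * Real.exp E * T₁) * (K⁻¹ * D₀ * (P * G⁻¹) * (1 / 2 * Zp)) := by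
    field_simp
  have hB : 0 ≤ 2 * K ^ 2 * G * Real.exp E * T₁ := by positivity
  calc Inum ≤ K * D₀ * P * (T₁ * (Real.exp E * Zp)) := hnum
    _ = (2 * K ^ 2 * G * Real.exp E * T₁) * (K⁻¹ * D₀ * (P * G⁻¹) * (1 / 2 * Zp)) := hid
    _ ≤ (2 * K ^ 2 * G * Real.exp E * T₁) * Iden := mul_le_mul_of_nonneg_left hden hB

/-- **The bracket** (opaque reals, `H` the only natural number): with `4s ≤ r`, `rH² ≤ ¼`, `n ≤ 216H⁴`, `s ≤ 1`:
`2·(e^{K₇⁺H⁴(1+log H)⁴(πr)²})²·e^{n((s/2)²/3+(s/2)⁴)}·e^{(9+15C₃)/2·(C₆πr)·n}·(6n·e^{−(β/2)s²/(3C₃)}) ≤ C_*·H⁴·e^{C_*·r·H⁴·(1+log H) − (6C₃)⁻¹·β·s²}`,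
`C_* = 2592 + 8π²K₇⁺ + 54 + 108π(9+15C₃)C₆ + 144C₃`. -/
theorem bracket_le_sharp (hH : 1 ≤ H) {n β r s C₃ C₆ K₇p : ℝ} (hs : 0 < s) (hs1 : s ≤ 1) (hsr : 4 * s ≤ r) (hrH : r * (H : ℝ) ^ 2 ≤ 1 / 4)
    (hn0 : 0 ≤ n) (hn : n ≤ 216 * (H : ℝ) ^ 4) (hC₃ : 0 < C₃) (hC₆ : 0 ≤ C₆) (hK₇p : 0 ≤ K₇p) :
    2 * Real.exp (K₇p * (H : ℝ) ^ 4 * (1 + Real.log H) ^ 4 * (Real.pi * r) ^ 2) ^ 2 *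
        Real.exp (n * ((s / 2) ^ 2 / 3 + (s / 2) ^ 4)) * Real.exp ((9 + 15 * C₃) / 2 * (C₆ * (Real.pi * r)) * n) *
        (6 * n * Real.exp (-(β / 2 * s ^ 2 / (3 * C₃)))) ≤
      (2592 + 8 * Real.pi ^ 2 * K₇p + 54 + 108 * Real.pi * (9 + 15 * C₃) * C₆ + 144 * C₃) * (H : ℝ) ^ 4 *
        Real.exp ((2592 + 8 * Real.pi ^ 2 * K₇p + 54 + 108 * Real.pi * (9 + 15 * C₃) * C₆ + 144 * C₃) * r * (H : ℝ) ^ 4 * (1 + Real.log H) -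
          1 / (6 * C₃) * β * s ^ 2) := by
  have hH' : (1 : ℝ) ≤ H := by exact_mod_cast hH
  have hH4 : (1 : ℝ) ≤ (H : ℝ) ^ 4 := one_le_pow₀ hH'
  have hlog : 0 ≤ Real.log H := Real.log_nonneg hH'
  have hL1 : 1 ≤ 1 + Real.log H := by linarith
  have hπ : 0 < Real.pi := Real.pi_pos
  have hr : 0 < r := by linarith
  have hrH4 : 0 ≤ r * (H : ℝ) ^ 4 := by positivity
  set Cst : ℝ := 2592 + 8 * Real.pi ^ 2 * K₇p + 54 + 108 * Real.pi * (9 + 15 * C₃) * C₆ + 144 * C₃ with hCst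
  have hCst0 : 0 ≤ Cst := by rw [hCst]; positivity
  -- (a) determinant exponent
  have hL4 := GhostLogRatioProof.one_add_log_pow_four_le H hH
  have ea : 2 * (K₇p * (H : ℝ) ^ 4 * (1 + Real.log H) ^ 4 * (Real.pi * r) ^ 2) ≤ 8 * Real.pi ^ 2 * K₇p * (r * (H : ℝ) ^ 4) := by
    -- `(1+log H)⁴ (πr)² H⁴ ≤ 16H²·π²r²·H⁴ = 16π² (rH²)·rH⁴ ≤ 4π² rH⁴`
    have h1 : (1 + Real.log H) ^ 4 * (Real.pi * r) ^ 2 ≤ 16 * (H : ℝ) ^ 2 * (Real.pi * r) ^ 2 :=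
      mul_le_mul_of_nonneg_right hL4 (sq_nonneg _)
    have h2 : 16 * (H : ℝ) ^ 2 * (Real.pi * r) ^ 2 = 16 * Real.pi ^ 2 * (r * (H : ℝ) ^ 2) * r := by ring
    have h3 : 16 * Real.pi ^ 2 * (r * (H : ℝ) ^ 2) * r ≤ 16 * Real.pi ^ 2 * (1 / 4) * r :=
      mul_le_mul_of_nonneg_right (mul_le_mul_of_nonneg_left hrH (by positivity)) hr.le
    have h4 : (1 + Real.log H) ^ 4 * (Real.pi * r) ^ 2 ≤ 4 * Real.pi ^ 2 * r := by linarith [h1, h3, h2.le, h2.ge]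
    have h5 := mul_le_mul_of_nonneg_left h4 (by positivity : (0:ℝ) ≤ K₇p * (H : ℝ) ^ 4)
    calc 2 * (K₇p * (H : ℝ) ^ 4 * (1 + Real.log H) ^ 4 * (Real.pi * r) ^ 2)
        = 2 * (K₇p * (H : ℝ) ^ 4 * ((1 + Real.log H) ^ 4 * (Real.pi * r) ^ 2)) := by ring
      _ ≤ 2 * (K₇p * (H : ℝ) ^ 4 * (4 * Real.pi ^ 2 * r)) := by linarith [h5]
      _ = 8 * Real.pi ^ 2 * K₇p * (r * (H : ℝ) ^ 4) := by ring
  -- (b) Haar exponent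
  have eb : n * ((s / 2) ^ 2 / 3 + (s / 2) ^ 4) ≤ 54 * (r * (H : ℝ) ^ 4) := by
    have hφ : (s / 2) ^ 2 / 3 + (s / 2) ^ 4 ≤ s ^ 2 := by
      have h4 : (s / 2) ^ 4 ≤ (s / 2) ^ 2 := by
        have : (s / 2) ^ 4 = (s / 2) ^ 2 * (s / 2) ^ 2 := by ring
        rw [this]; exact mul_le_of_le_one_left (sq_nonneg _) (by nlinarith)
      nlinarith [sq_nonneg s]
    have hs2 : s ^ 2 ≤ r / 4 := by nlinarith
    calc n * ((s / 2) ^ 2 / 3 + (s / 2) ^ 4) ≤ 216 * (H : ℝ) ^ 4 * (r / 4) :=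
          mul_le_mul hn (hφ.trans hs2) (by positivity) (by positivity)
      _ = 54 * (r * (H : ℝ) ^ 4) := by ring
  -- (c) mass-ratio exponent
  have ec : (9 + 15 * C₃) / 2 * (C₆ * (Real.pi * r)) * n ≤ 108 * Real.pi * (9 + 15 * C₃) * C₆ * (r * (H : ℝ) ^ 4) := by
    have h0 : 0 ≤ (9 + 15 * C₃) / 2 * (C₆ * (Real.pi * r)) := by positivity
    calc (9 + 15 * C₃) / 2 * (C₆ * (Real.pi * r)) * n ≤ (9 + 15 * C₃) / 2 * (C₆ * (Real.pi * r)) * (216 * (H : ℝ) ^ 4) :=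
          mul_le_mul_of_nonneg_left hn h0
      _ = 108 * Real.pi * (9 + 15 * C₃) * C₆ * (r * (H : ℝ) ^ 4) := by ring
  -- the total exponent
  have hexp : 2 * (K₇p * (H : ℝ) ^ 4 * (1 + Real.log H) ^ 4 * (Real.pi * r) ^ 2) + n * ((s / 2) ^ 2 / 3 + (s / 2) ^ 4) +
      (9 + 15 * C₃) / 2 * (C₆ * (Real.pi * r)) * n + -(β / 2 * s ^ 2 / (3 * C₃)) ≤
      Cst * r * (H : ℝ) ^ 4 * (1 + Real.log H) - 1 / (6 * C₃) * β * s ^ 2 := by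
    have hsum : 8 * Real.pi ^ 2 * K₇p * (r * (H : ℝ) ^ 4) + 54 * (r * (H : ℝ) ^ 4) + 108 * Real.pi * (9 + 15 * C₃) * C₆ * (r * (H : ℝ) ^ 4)
        ≤ Cst * (r * (H : ℝ) ^ 4) := by
      rw [hCst]; nlinarith [hrH4, hC₃.le]
    have hmono : Cst * (r * (H : ℝ) ^ 4) ≤ Cst * r * (H : ℝ) ^ 4 * (1 + Real.log H) := by
      have := mul_le_mul_of_nonneg_left hL1 (mul_nonneg hCst0 hrH4)
      calc Cst * (r * (H : ℝ) ^ 4) = Cst * (r * (H : ℝ) ^ 4) * 1 := by ring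
        _ ≤ Cst * (r * (H : ℝ) ^ 4) * (1 + Real.log H) := this
        _ = Cst * r * (H : ℝ) ^ 4 * (1 + Real.log H) := by ring
    have hβs : -(β / 2 * s ^ 2 / (3 * C₃)) = -(1 / (6 * C₃) * β * s ^ 2) := by field_simp; ring
    rw [hβs]
    linarith [ea, eb, ec, hsum, hmono]
  -- the prefactor
  have hpre : 2 * (6 * n) ≤ Cst * (H : ℝ) ^ 4 := by
    have h1 : 0 ≤ 8 * Real.pi ^ 2 * K₇p := by positivity
    have h2 : 0 ≤ 108 * Real.pi * (9 + 15 * C₃) * C₆ := by positivity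
    have h3 : (2592 : ℝ) ≤ Cst := by rw [hCst]; linarith [hC₃.le]
    calc 2 * (6 * n) ≤ 2592 * (H : ℝ) ^ 4 := by nlinarith
      _ ≤ Cst * (H : ℝ) ^ 4 := mul_le_mul_of_nonneg_right h3 (by positivity)
  -- combine
  have hK2 : Real.exp (K₇p * (H : ℝ) ^ 4 * (1 + Real.log H) ^ 4 * (Real.pi * r) ^ 2) ^ 2 =
      Real.exp (2 * (K₇p * (H : ℝ) ^ 4 * (1 + Real.log H) ^ 4 * (Real.pi * r) ^ 2)) := by
    rw [← Real.exp_nat_mul]; norm_num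
  rw [hK2]
  calc 2 * Real.exp (2 * (K₇p * (H : ℝ) ^ 4 * (1 + Real.log H) ^ 4 * (Real.pi * r) ^ 2)) * Real.exp (n * ((s / 2) ^ 2 / 3 + (s / 2) ^ 4)) *
          Real.exp ((9 + 15 * C₃) / 2 * (C₆ * (Real.pi * r)) * n) * (6 * n * Real.exp (-(β / 2 * s ^ 2 / (3 * C₃))))
      = (2 * (6 * n)) * Real.exp (2 * (K₇p * (H : ℝ) ^ 4 * (1 + Real.log H) ^ 4 * (Real.pi * r) ^ 2) + n * ((s / 2) ^ 2 / 3 + (s / 2) ^ 4) +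
          (9 + 15 * C₃) / 2 * (C₆ * (Real.pi * r)) * n + -(β / 2 * s ^ 2 / (3 * C₃))) := by
        rw [Real.exp_add, Real.exp_add, Real.exp_add]; ring
    _ ≤ (Cst * (H : ℝ) ^ 4) * Real.exp (Cst * r * (H : ℝ) ^ 4 * (1 + Real.log H) - 1 / (6 * C₃) * β * s ^ 2) :=
        mul_le_mul hpre (Real.exp_le_exp.2 hexp) (Real.exp_pos _).le (by positivity)
    _ = Cst * (H : ℝ) ^ 4 * Real.exp (Cst * r * (H : ℝ) ^ 4 * (1 + Real.log H) - 1 / (6 * C₃) * β * s ^ 2) := by ring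

/-! ## The assembly -/

/-- ★★ **T-S5.6′ `SmallFieldInsideFPSharp`, def-free form** (the typed Prop's body, token for token): for `H ≥ 1`, `β ≥ 1`, `0 < s`, `4s ≤ r`, `r·H² ≤ c₀`,
`C(1 + log H) ≤ βs²`:  `∫_{chartDomain ∖ smallField s} w_J ≤ C·H⁴·exp(C·r·H⁴·(1 + log H) − c·β·s²) · ∫_{smallField (s/2)} w_J`. -/
theorem smallFieldInsideFP_sharp :
    ∃ C c c₀ : ℝ, 0 < c ∧ 0 < c₀ ∧ ∀ H : ℕ, 1 ≤ H → ∀ β r s : ℝ, 1 ≤ β → 0 < s → 4 * s ≤ r → r * (H : ℝ) ^ 2 ≤ c₀ →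
      C * (1 + Real.log H) ≤ β * s ^ 2 →
      ∫ a in chartDomain H \ smallField H s, fpChartWeight β H r a ≤
        C * (H : ℝ) ^ 4 * Real.exp (C * r * (H : ℝ) ^ 4 * (1 + Real.log H) - c * β * s ^ 2) *
          ∫ a in smallField H (s / 2), fpChartWeight β H r a := by
  obtain ⟨C₆, hC₆, h6⟩ := abs_action_sub_boxQuadForm_le_sharp
  obtain ⟨K₇, c₇, hc₇, h7⟩ := ghostDetRatio_sq_le
  obtain ⟨C₃', hC₃'⟩ := landauVarianceBounded
  -- positive versions of the constants
  set K₇p := max K₇ 0 with hK₇p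
  set C₃ := max C₃' 1 with hC₃def
  have hK₇p0 : 0 ≤ K₇p := le_max_right _ _
  have hC₃ : 1 ≤ C₃ := le_max_right _ _
  have hC₃pos : 0 < C₃ := by linarith
  have hπ : 0 < Real.pi := Real.pi_pos
  have hπ3 : 3 < Real.pi := Real.pi_gt_three
  have hπ4 : Real.pi < 4 := by linarith [Real.pi_lt_d2]
  -- the constants of the statement
  set c₀ : ℝ := min (min (c₇ / Real.pi) (1 / (1376 * Real.pi * C₆))) (1 / 4) with hc₀def
  set C : ℝ := 2592 + 8 * Real.pi ^ 2 * K₇p + 54 + 108 * Real.pi * (9 + 15 * C₃) * C₆ + 144 * C₃ with hCdef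
  have hc₀pos : 0 < c₀ := by
    rw [hc₀def]
    exact lt_min (lt_min (div_pos hc₇ hπ) (by positivity)) (by norm_num)
  have hc₀7 : c₀ ≤ c₇ / Real.pi := (min_le_left _ _).trans (min_le_left _ _)
  have hc₀δ : c₀ ≤ 1 / (1376 * Real.pi * C₆) := (min_le_left _ _).trans (min_le_right _ _)
  have hc₀4 : c₀ ≤ 1 / 4 := min_le_right _ _
  refine ⟨C, 1 / (6 * C₃), c₀, by positivity, hc₀pos, ?_⟩
  intro H hH β r s hβ hs hsr hrH hCβ
  have hH' : (1 : ℝ) ≤ H := by exact_mod_cast hH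
  have hβpos : 0 < β := by linarith
  have hlog : 0 ≤ Real.log H := Real.log_nonneg hH'
  have hH2 : (1 : ℝ) ≤ (H : ℝ) ^ 2 := one_le_pow₀ hH'
  -- the basic geometry of the parameters
  have hr : 0 < r := by linarith
  have hrc : r ≤ c₀ := le_trans (le_mul_of_one_le_right hr.le hH2) hrH
  have hr4 : r ≤ 1 / 4 := hrc.trans hc₀4
  have hrH4 : r * (H : ℝ) ^ 2 ≤ 1 / 4 := hrH.trans hc₀4
  have hs1 : s ≤ 1 := by linarith
  have hvar : ∀ e : LandauFree H, (hodgeQ H)⁻¹ e e ≤ C₃ := fun e => (hC₃' H hH e).trans (le_max_left _ _)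
  -- the support level `T = π r`
  have hT0 : 0 ≤ Real.pi * r := by positivity
  have hT1 : Real.pi * r ≤ 1 := by nlinarith
  have hTH2 : Real.pi * r * (H : ℝ) ^ 2 ≤ c₇ := by
    have h1 : Real.pi * (r * (H : ℝ) ^ 2) ≤ Real.pi * c₀ := mul_le_mul_of_nonneg_left hrH hπ.le
    have h2 : Real.pi * c₀ ≤ c₇ := by
      have h := (le_div_iff₀ hπ).1 hc₀7
      linarith only [h, mul_comm Real.pi c₀]
    calc Real.pi * r * (H : ℝ) ^ 2 = Real.pi * (r * (H : ℝ) ^ 2) := by ring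
      _ ≤ c₇ := h1.trans h2
  -- `δ = C₆ π r`, `1376 H² δ ≤ 1`
  have hδ0 : 0 ≤ C₆ * (Real.pi * r) := by positivity
  have hδ : 1376 * (H : ℝ) ^ 2 * (C₆ * (Real.pi * r)) ≤ 1 := by
    have h1 : 1376 * Real.pi * C₆ * (r * (H : ℝ) ^ 2) ≤ 1376 * Real.pi * C₆ * c₀ := mul_le_mul_of_nonneg_left hrH (by positivity)
    have h2 : 1376 * Real.pi * C₆ * c₀ ≤ 1 := by
      have h := (le_div_iff₀ (by positivity : (0:ℝ) < 1376 * Real.pi * C₆)).1 hc₀δ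
      linarith only [h, mul_comm (1376 * Real.pi * C₆) c₀]
    calc 1376 * (H : ℝ) ^ 2 * (C₆ * (Real.pi * r)) = 1376 * Real.pi * C₆ * (r * (H : ℝ) ^ 2) := by ring
      _ ≤ 1 := h1.trans h2
  -- the sharp sandwich at level `T`
  have hsand : ∀ a : LandauFree H → E3, (∀ e, ‖a e‖ ≤ Real.pi * r) →
      |boxWilson H (edgeChart H a) + landauPhi H (edgeChart H a) - boxQuadForm H a| ≤
        C₆ * (Real.pi * r) * (boxQuadForm H a + ∑ e, ‖a e‖ ^ 2) :=
    fun a ha => h6 H hH (Real.pi * r) hT0 hT1 a ha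
  -- the relative sandwich (for integrability only): `ε = δ(1 + 344H²) ≤ 1`
  have hsandRel : ∀ a : LandauFree H → E3, (∀ e, ‖a e‖ ≤ Real.pi * r) →
      |boxWilson H (edgeChart H a) + landauPhi H (edgeChart H a) - boxQuadForm H a| ≤
        C₆ * (Real.pi * r) * (1 + 344 * (H : ℝ) ^ 2) * boxQuadForm H a := by
    intro a ha
    have h := hsand a ha
    have hN := BoxQuadForm.sum_norm_sq_le_boxQuadForm hH a
    have hQ := BoxQuadForm.boxQuadForm_nonneg hH a
    refine h.trans ?_
    have : boxQuadForm H a + ∑ e, ‖a e‖ ^ 2 ≤ (1 + 344 * (H : ℝ) ^ 2) * boxQuadForm H a := by linarith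
    calc C₆ * (Real.pi * r) * (boxQuadForm H a + ∑ e, ‖a e‖ ^ 2) ≤ C₆ * (Real.pi * r) * ((1 + 344 * (H : ℝ) ^ 2) * boxQuadForm H a) :=
          mul_le_mul_of_nonneg_left this hδ0
      _ = C₆ * (Real.pi * r) * (1 + 344 * (H : ℝ) ^ 2) * boxQuadForm H a := by ring
  have hε1 : C₆ * (Real.pi * r) * (1 + 344 * (H : ℝ) ^ 2) ≤ 1 := by nlinarith [hδ, hδ0, hH2]
  -- the determinant comparison at level `T` (h6b′), against the base point `0`
  set K : ℝ := Real.exp (K₇p * (H : ℝ) ^ 4 * (1 + Real.log H) ^ 4 * (Real.pi * r) ^ 2) with hKdef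
  have hK : 0 < K := Real.exp_pos _
  set D₀ : ℝ := |(fpOperator H (edgeChart H 0)).det| with hD₀def
  have hD₀ : 0 ≤ D₀ := abs_nonneg _
  have h0mem : (0 : LandauFree H → E3) ∈ smallField H (Real.pi * r) := fun e => by simp [hT0]
  have hKle : Real.exp (K₇ * (H : ℝ) ^ 4 * (1 + Real.log H) ^ 4 * (Real.pi * r) ^ 2) ≤ K :=
    Real.exp_le_exp.2 (mul_le_mul_of_nonneg_right (mul_le_mul_of_nonneg_right
      (mul_le_mul_of_nonneg_right (le_max_left _ _) (by positivity)) (by positivity)) (sq_nonneg _))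
  have hdet : ∀ a : LandauFree H → E3, a ∈ smallField H (Real.pi * r) →
      |(fpOperator H (edgeChart H a)).det| ≤ K * D₀ ∧ D₀ ≤ K * |(fpOperator H (edgeChart H a)).det| := by
    intro a ha
    constructor
    · exact (h7 H hH _ hT0 hTH2 a 0 ha h0mem).trans (mul_le_mul_of_nonneg_right hKle hD₀)
    · exact (h7 H hH _ hT0 hTH2 0 a h0mem ha).trans (mul_le_mul_of_nonneg_right hKle (abs_nonneg _))
  clear_value D₀
  clear h6 h7 hC₃'
  -- the two integral bounds
  have hU := setIntegral_diff_le_sharp (s := s) hH hβpos hr.le hδ0 hδ hK.le hD₀ hsand (fun a ha => (hdet a ha).1)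
  have ht0 : 0 ≤ s / 2 := by linarith only [hs]
  have htr : s / 2 ≤ r := by linarith only [hs, hsr]
  have ht1 : s / 2 ≤ 1 := by linarith only [hs, hs1]
  have htT : s / 2 ≤ Real.pi * r := by nlinarith only [hπ3, hsr, hs]
  have hL := le_setIntegral_smallField_sharp hH hβpos hr ht0 htr ht1 htT hδ0 hε1 hK hD₀ hsand hsandRel hdet
  -- the Gaussian inputs
  have htail := setIntegral_compl_smallField_twoFormMinus_le hH (s := s) hβpos hδ0 hδ hs.le hC₃pos hvar
  have hratio := integral_exp_twoFormMinus_le hH hβpos hδ0 hδ hvar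
  have hbox := le_setIntegral_smallField_twoFormPlus (H := H) (δ := C₆ * (Real.pi * r)) hβpos hδ0 ht0 hC₃pos hvar
  have hZp := integral_exp_twoFormPlus_pos (H := H) (δ := C₆ * (Real.pi * r)) hβpos hδ0
  have hn := card_landauFree_le hH
  have h144 : 144 * C₃ ≤ C := by
    rw [hCdef]
    have h1 : 0 ≤ 8 * Real.pi ^ 2 * K₇p := by positivity
    have h2 : 0 ≤ 108 * Real.pi * (9 + 15 * C₃) * C₆ := by positivity
    linarith
  have hhalf := six_card_exp_le_half hH hn hC₃pos h144 hCβ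
  -- ratio assembly and bracket (opaque arithmetic)
  have hmain := sharp_ratio_assembly hK hD₀ (by positivity) hZp (by positivity) hU htail hratio hL hbox hhalf
  have hbr := bracket_le_sharp (β := β) hH hs hs1 hsr hrH4 (Nat.cast_nonneg _) hn hC₃pos hC₆.le hK₇p0
  have hIden : 0 ≤ ∫ a in smallField H (s / 2), fpChartWeight β H r a :=
    setIntegral_nonneg (ChartGauss.measurableSet_smallField _) fun a _ => FPChart.fpChartWeight_nonneg β r a
  exact hmain.trans (mul_le_mul_of_nonneg_right hbr hIden)

end SmallFieldFPSharp

end Summit.QuantumFields.YangMills.Theorems.AllWindowsColdBoxBoxHighLine
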